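import Summits.HubbardSuperconductivity.HubbardLadder.Bounds.PairCorrelationEtaLineEuclidTPrime
import Literature.MathematicalPhysics.QuantumLattice.HubbardSignGaugeBoundTTPrime
import HarnessLib
import HarnessLib.Audit

/-!
# The sharp magnetic `η`-line and one-particle decay of the `t–t'` Hubbard class (bounds.tex Thm 10‴(t′))

HONEST FRAMING: ladder R1–R4 with certified numbers; no claim on H/H₀. This file is a rigorous
statement about a MODEL CLASS (the square-lattice `t–t'` Hubbard model `𝔥(t,t')` at every `U`
and every filling), not about any material.

## What is proved (no `sorry`, no hypotheses beyond Literature theorems)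

For the grand-canonical `t–t'` Hubbard model `H_{t,t'}(U) - μN` on the torus `(ℤ/Lℤ)²`
(`hubbardTorusTT'`, Xu et al. 2024 eq. (1)), all real `t, t', U, μ`, `β ≥ 0`, every `q ≥ 0`:

* (magnetic) with `f = 4q - 4πβ(|t| + 2|t'|)q² ≥ 0`,
  `|⟨S⁺_x S⁻_y⟩_{β,L}| ≤ K · 5^f · (dist(x,y) + 1)^{-f}` uniformly in `L`
  (`norm_spinCorr_ttPrime_le_rpow_euclid`); optimising, `f* = T/(π(|t| + 2|t'|))`, so
  `η_spin(T) ≥ T/(π(|t| + 2|t'|))` and `η_spin > 1/4` — no in-plane magnetic quasi-long-range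
  order of Kosterlitz–Thouless type — for ALL `T > (π/4)(|t| + 2|t'|)` (`t' = -0.2t`: `T > 1.10|t|`),
  every `U`, every `μ`: node `SpinEtaLineEuclidTPrime` (PROVED);
* (one-particle) with `f = 2q - 4πβ(|t| + 2|t'|)q² ≥ 0`, the same bound for `|⟨c†_{xσ} c_{yσ}⟩_{β,L}|`
  (`norm_green_ttPrime_le_rpow_euclid`); `f₁* = T/(4π(|t| + 2|t'|))`: node
  `GreenDecayEuclidTPrime` (PROVED).

Here `K = exp[2β(|t|(2πq² + 76q² + 544q⁴e^{2q²}) + |t'|(4πq² + 289q² + 3402q⁴e^{2q²}))]`.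

## How

Step 1 (Literature `HubbardSignGaugeBoundTTPrime`): Koma–Tasaki's gauge bound with the hopping
norm of eq. (11) AS PRINTED, carried through the SIGN gauges `θ_{uσ} = -iε_σψ_u` for the sum of
the nearest-neighbour and the diagonal hopping Hamiltonians (note 9 of the source): a priori bounds
`e^{-c(ψ_x-ψ_y)} exp[β(|t| Σ_{n.n.} + |t'| Σ_{diag})(cosh(ψ_u - ψ_v) - 1)]` with gauge charge
`c = 2` (`S⁺S⁻`, spin gauge) and `c = 1` (`c†c`, charge gauge).
Step 2 (Literature `TorusEuclidLogDipoleDiag.exists_euclidLogDipole_two_graphs`): the explicit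
Euclidean logarithmic dipole, gain `2q log ρ`, nearest-neighbour energy
`≤ 2(2πq²H_ρ + 76q² + 544q⁴e^{2q²})`, diagonal energy `≤ 2(4πq²H_ρ + 289q² + 3402q⁴e^{2q²})`
(`|e₁ ± e₂|² = 2` doubles the logarithmic coefficient — the `2|t'|`).
Step 3 (`le_rpow_euclid_two_graphs_of_apriori`, generic in the charge `c` and the costs): with
`H_ρ ≤ 1 + log ρ`, `ρ = ⌊(dist-1)/2⌋ ≥ (dist+1)/5`.

Compare: the pair version `PairEtaLineEuclidTPrime` (same line `T > (π/4)(|t| + 2|t'|)`, in tree)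
and the pure-Hubbard magnetic line `SpinEtaLineEuclid` (`T > (π/4)|t|`). NOT claimed: optimality of
the exponent within the method (bounds.tex Thm 10 (iv), paper only), any bound on a BKT
temperature, anything about materials.

References (keys of `lean/references.bib`): KomaTasakiPRL1992 (Theorem, eqs. (5)–(13), last
paragraph of the proof, note 9); McBryanSpencer1977; NelsonKosterlitz1977; XuEtAl2024 (eq. (1)).
-/

noncomputable section

namespace Summit.HubbardSuperconductivity.HubbardLadder.Bounds

open Matrix Finset NormedSpace
open Literature.MathematicalPhysics.QuantumLattice Literature.Probability.LatticeModels
open scoped Matrix.Norms.L2Operator ComplexOrder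

/-! ### Generic step: two-graph a priori gauge bound ⟹ explicit power law -/

/-- **From a two-graph a priori gauge bound to the Euclidean-dipole power law.** If a real number
`g` obeys, for every real `φ` on `(ℤ/Lℤ)²`,
`g ≤ e^{-c(φ_x - φ_y)} exp[b (a₁ Σ_{n.n.} + a₂ Σ_{diag}) (cosh(φ_u - φ_v) - 1)]` (`b, a₁, a₂ ≥ 0`),
then for every `q ≥ 0` with `f = 2cq - 4πb(a₁ + 2a₂)q² ≥ 0`:
`g ≤ exp[2b(a₁(2πq² + 76q² + 544q⁴e^{2q²}) + a₂(4πq² + 289q² + 3402q⁴e^{2q²}))] 5^f (dist(x,y)+1)^{-f}`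
(short distances: `φ = 0`; else the Euclidean dipole of `exists_euclidLogDipole_two_graphs` with
`ρ = ⌊(dist-1)/2⌋`, `H_ρ ≤ 1 + log ρ`, `ρ ≥ (dist+1)/5`). -/
theorem le_rpow_euclid_two_graphs_of_apriori (L : ℕ) [NeZero L] (b a₁ a₂ c q g f : ℝ)
    (hb : 0 ≤ b) (ha₁ : 0 ≤ a₁) (ha₂ : 0 ≤ a₂) (hq : 0 ≤ q) (x y : TorusSite 2 L)
    (hAP : ∀ φ : TorusSite 2 L → ℝ,
      g ≤ Real.exp (-(c * (φ x - φ y))) * Real.exp (b * (a₁ *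
          (∑ u : TorusSite 2 L, ∑ v : TorusSite 2 L,
            (if (torusGraph 2 L).Adj u v then (Real.cosh (φ u - φ v) - 1) else 0)) +
        a₂ * ∑ u : TorusSite 2 L, ∑ v : TorusSite 2 L,
            (if (torusDiagGraph L).Adj u v then (Real.cosh (φ u - φ v) - 1) else 0))))
    (hfq : f = 2 * c * q - 4 * Real.pi * (b * (a₁ + 2 * a₂)) * q ^ 2) (hf : 0 ≤ f) :
    g ≤ Real.exp (2 * b * (a₁ * (2 * Real.pi * q ^ 2 + 76 * q ^ 2 +
            544 * q ^ 4 * Real.exp (2 * q ^ 2)) +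
          a₂ * (4 * Real.pi * q ^ 2 + 289 * q ^ 2 + 3402 * q ^ 4 * Real.exp (2 * q ^ 2)))) *
        ((5 : ℝ) ^ f * ((torusDist x y : ℝ) + 1) ^ (-f)) := by
  set K : ℝ := Real.exp (2 * b * (a₁ * (2 * Real.pi * q ^ 2 + 76 * q ^ 2 +
      544 * q ^ 4 * Real.exp (2 * q ^ 2)) +
    a₂ * (4 * Real.pi * q ^ 2 + 289 * q ^ 2 + 3402 * q ^ 4 * Real.exp (2 * q ^ 2)))) with hK
  have hK1 : 1 ≤ K := Real.one_le_exp (by positivity)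
  set R : ℕ := torusDist x y with hR
  have hR1 : (0 : ℝ) < (R : ℝ) + 1 := by positivity
  by_cases hR3 : R < 3
  · -- short distances: the bound with `φ = 0` is `g ≤ 1 ≤ K 5^f (R+1)^{-f}` (`R + 1 ≤ 5`)
    have h0 := hAP (fun _ => 0)
    simp only [sub_self, mul_zero, neg_zero, Real.cosh_zero, ite_self, sum_const_zero, add_zero,
      Real.exp_zero, mul_one] at h0
    have hge1 : 1 ≤ (5 : ℝ) ^ f * ((R : ℝ) + 1) ^ (-f) := by
      rw [Real.rpow_neg hR1.le, ← div_eq_mul_inv, ← Real.div_rpow (by norm_num) hR1.le]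
      refine Real.one_le_rpow ?_ hf
      rw [le_div_iff₀ hR1]
      have : (R : ℝ) ≤ 2 := by exact_mod_cast (by omega : R ≤ 2)
      linarith
    calc g ≤ 1 := h0
      _ ≤ K * ((5 : ℝ) ^ f * ((R : ℝ) + 1) ^ (-f)) := by nlinarith
  · -- the Euclidean dipole of radius `ρ = ⌊(R-1)/2⌋ ≥ 1` on both bond graphs
    have hR3' : 3 ≤ R := not_lt.1 hR3
    set ρ : ℕ := (R - 1) / 2 with hρdef
    have hρ1 : 1 ≤ ρ := by omega
    have hρR : 2 * ρ + 1 ≤ torusDist x y := by rw [← hR]; omega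
    have h5ρ : R + 1 ≤ 5 * ρ := by omega
    obtain ⟨φ, hgain, hE₁, hE₂⟩ := exists_euclidLogDipole_two_graphs L x y q hq ρ hρ1 hρR
    have key := hAP φ
    rw [hgain] at key
    have hρ0 : (0 : ℝ) < (ρ : ℝ) := by exact_mod_cast hρ1
    have hH : (harmonic ρ : ℝ) ≤ 1 + Real.log ρ := harmonic_le_one_add_log ρ
    have hfifth : ((R : ℝ) + 1) / 5 ≤ (ρ : ℝ) := by
      have h' : ((R : ℝ) + 1) ≤ 5 * (ρ : ℝ) := by exact_mod_cast h5ρ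
      linarith
    have hfifth0 : (0 : ℝ) < ((R : ℝ) + 1) / 5 := by positivity
    calc g ≤ Real.exp (-(c * (2 * q * Real.log ρ))) * Real.exp (b * (a₁ *
            (∑ u : TorusSite 2 L, ∑ v : TorusSite 2 L,
              (if (torusGraph 2 L).Adj u v then (Real.cosh (φ u - φ v) - 1) else 0)) +
            a₂ * ∑ u : TorusSite 2 L, ∑ v : TorusSite 2 L,
              (if (torusDiagGraph L).Adj u v then (Real.cosh (φ u - φ v) - 1) else 0))) := key
      _ ≤ Real.exp (-(c * (2 * q * Real.log ρ))) * Real.exp (b * (a₁ *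
            (2 * (2 * Real.pi * q ^ 2 * (harmonic ρ : ℝ) + 76 * q ^ 2 +
              544 * q ^ 4 * Real.exp (2 * q ^ 2))) +
            a₂ * (2 * (4 * Real.pi * q ^ 2 * (harmonic ρ : ℝ) + 289 * q ^ 2 +
              3402 * q ^ 4 * Real.exp (2 * q ^ 2))))) := by
          gcongr
      _ ≤ Real.exp (-(c * (2 * q * Real.log ρ))) * Real.exp (b * (a₁ *
            (2 * (2 * Real.pi * q ^ 2 * (1 + Real.log ρ) + 76 * q ^ 2 +
              544 * q ^ 4 * Real.exp (2 * q ^ 2))) +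
            a₂ * (2 * (4 * Real.pi * q ^ 2 * (1 + Real.log ρ) + 289 * q ^ 2 +
              3402 * q ^ 4 * Real.exp (2 * q ^ 2))))) := by
          gcongr
      _ = K * Real.exp (-(f * Real.log ρ)) := by
          rw [hK, ← Real.exp_add, ← Real.exp_add, hfq]
          congr 1
          ring
      _ = K * (ρ : ℝ) ^ (-f) := by
          rw [Real.rpow_def_of_pos hρ0]
          congr 2
          ring
      _ ≤ K * (((R : ℝ) + 1) / 5) ^ (-f) := by
          gcongr K * ?_
          exact Real.rpow_le_rpow_of_nonpos hfifth0 hfifth (by linarith)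
      _ = K * ((5 : ℝ) ^ f * ((R : ℝ) + 1) ^ (-f)) := by
          rw [Real.div_rpow hR1.le (by norm_num), Real.rpow_neg (by norm_num : (0:ℝ) ≤ 5),
            div_inv_eq_mul, mul_comm (((R : ℝ) + 1) ^ (-f))]

/-! ### The magnetic correlation of the `t–t'` model: explicit power law -/

/-- **Sharp explicit power law for the transverse spin correlation of the `t–t'` model** (bounds.tex
Thm 10‴(t′)). For all real `t, t', U, μ`, `β ≥ 0`, `q ≥ 0` with
`f = 4q - 4πβ(|t| + 2|t'|)q² ≥ 0`, every torus `L ≥ 1` and all sites `x, y`: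
`|⟨S⁺_x S⁻_y⟩_{β,L}| ≤ K 5^f (dist(x,y) + 1)^{-f}`. With `q* = 1/(2πβ(|t|+2|t'|))`:
`f* = T/(π(|t| + 2|t'|))`. -/
theorem norm_spinCorr_ttPrime_le_rpow_euclid (L : ℕ) [NeZero L] (t t' U μ β q : ℝ)
    (hβ : 0 ≤ β) (hq : 0 ≤ q)
    (hf : 0 ≤ 4 * q - 4 * Real.pi * (β * (|t| + 2 * |t'|)) * q ^ 2) (x y : TorusSite 2 L) :
    ‖(hubbardTorusTT' L t t' U - (μ : ℂ) • totalNumber).thermalCorr β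
        (siteSpinPlus x) (siteSpinPlus y)ᴴ‖ ≤
      Real.exp (2 * β * (|t| * (2 * Real.pi * q ^ 2 + 76 * q ^ 2 +
            544 * q ^ 4 * Real.exp (2 * q ^ 2)) +
          |t'| * (4 * Real.pi * q ^ 2 + 289 * q ^ 2 + 3402 * q ^ 4 * Real.exp (2 * q ^ 2)))) *
        ((5 : ℝ) ^ (4 * q - 4 * Real.pi * (β * (|t| + 2 * |t'|)) * q ^ 2) *
          ((torusDist x y : ℝ) + 1) ^ (-(4 * q - 4 * Real.pi * (β * (|t| + 2 * |t'|)) * q ^ 2))) :=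
  le_rpow_euclid_two_graphs_of_apriori L β |t| |t'| 2 q _ _ hβ (abs_nonneg t) (abs_nonneg t') hq
    x y (fun φ => norm_thermalCorr_siteSpinPlus_ttPrime_le_sharp t t' U μ hβ φ x y) (by ring) hf

/-! ### The sharp magnetic `η`-line of the `t–t'` class, torus-uniform form -/

/-- **Cor 10.1‴(t′) (torus form, `t–t'` model, magnetic, sharp constant; PROVED below).**
Grand-canonical `t–t'` Hubbard model `H_{t,t'}(U) - μN` on `(ℤ/Lℤ)²`, any real `t, t', U, μ`,
`β > 0` with `β(|t| + 2|t'|) < 4/π` (temperature `T > (π/4)(|t| + 2|t'|)`; for `t' = -0.2t`: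
`T > 1.10|t|`): there are `f > 1/4` and `C` with `|⟨S⁺_x S⁻_y⟩_{β,L}| ≤ C (dist(x,y)+1)^{-f}` for
EVERY `L ≥ 1` and all `x, y` — no in-plane magnetic quasi-long-range order of Kosterlitz–Thouless
type (`η ≤ 1/4`) there, whatever `U` and the filling. The magnetic twin of `PairEtaLineEuclidTPrime`
(same line). kind: support (PROVED). Why it might fail: it cannot (proved); NOT claimed: optimality
of the exponent within the method (bounds.tex Thm 10 (iv)), any statement about `S^z` or staggered
order parameters beyond what the bound says, or any bound on a BKT temperature.
Sources: KomaTasakiPRL1992 Theorem, eqs. (11)–(13), last paragraph of the proof, note 9;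
McBryanSpencer1977; NelsonKosterlitz1977; XuEtAl2024 eq. (1); this cell bounds.tex Thm 10‴. -/
@[conjecture] def SpinEtaLineEuclidTPrime : Prop :=
  ∀ (t t' U μ β : ℝ), 0 < β → β * (|t| + 2 * |t'|) < 4 / Real.pi →
    ∃ f C : ℝ, 1 / 4 < f ∧ ∀ (L : ℕ) [NeZero L] (x y : TorusSite 2 L),
      ‖(hubbardTorusTT' L t t' U - (μ : ℂ) • totalNumber).thermalCorr β
          (siteSpinPlus x) (siteSpinPlus y)ᴴ‖ ≤
        C * ((torusDist x y : ℝ) + 1) ^ (-f)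

/-- **`SpinEtaLineEuclidTPrime` holds** (with `b = β(|t| + 2|t'|)`: witness `q = 1/4` when
`πb ≤ 2`, `f = 1 - πb/4 ≥ 1/2`; else `q = 1/(2πb)`, `f = 1/(πb) > 1/4`; `C = K 5^f`). -/
theorem spinEtaLineEuclidTPrime_holds : SpinEtaLineEuclidTPrime := by
  intro t t' U μ β hβ hb
  set b : ℝ := β * (|t| + 2 * |t'|) with hbdef
  have hb0' : 0 ≤ b := by positivity
  have hπ := Real.pi_pos
  have hb4 : Real.pi * b < 4 := by
    have := (lt_div_iff₀ hπ).1 hb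
    linarith
  by_cases hc : Real.pi * b ≤ 2
  · -- `q = 1/4`
    have hf0 : 0 ≤ 4 * (1 / 4 : ℝ) - 4 * Real.pi * b * (1 / 4 : ℝ) ^ 2 := by nlinarith
    refine ⟨4 * (1 / 4 : ℝ) - 4 * Real.pi * b * (1 / 4 : ℝ) ^ 2,
      Real.exp (2 * β * (|t| * (2 * Real.pi * (1 / 4 : ℝ) ^ 2 + 76 * (1 / 4 : ℝ) ^ 2 +
          544 * (1 / 4 : ℝ) ^ 4 * Real.exp (2 * (1 / 4 : ℝ) ^ 2)) +
        |t'| * (4 * Real.pi * (1 / 4 : ℝ) ^ 2 + 289 * (1 / 4 : ℝ) ^ 2 +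
          3402 * (1 / 4 : ℝ) ^ 4 * Real.exp (2 * (1 / 4 : ℝ) ^ 2)))) *
        (5 : ℝ) ^ (4 * (1 / 4 : ℝ) - 4 * Real.pi * b * (1 / 4 : ℝ) ^ 2),
      by nlinarith, fun L _ x y => ?_⟩
    rw [mul_assoc]
    exact norm_spinCorr_ttPrime_le_rpow_euclid L t t' U μ β (1 / 4) hβ.le (by norm_num) hf0 x y
  · -- `q = q* = 1/(2πb)`
    have hc' : 2 < Real.pi * b := not_le.1 hc
    have hb0 : 0 < b := by
      rcases hb0'.eq_or_lt with h | h
      · rw [← h, mul_zero] at hc'; linarith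
      · exact h
    set q : ℝ := 1 / (2 * Real.pi * b) with hq
    have hq0 : 0 ≤ q := by positivity
    have hfval : 4 * q - 4 * Real.pi * b * q ^ 2 = 1 / (Real.pi * b) := by
      rw [hq]
      field_simp
      ring
    have hf4 : 1 / 4 < 4 * q - 4 * Real.pi * b * q ^ 2 := by
      rw [hfval, div_lt_div_iff₀ (by norm_num) (by positivity)]
      linarith
    refine ⟨4 * q - 4 * Real.pi * b * q ^ 2,
      Real.exp (2 * β * (|t| * (2 * Real.pi * q ^ 2 + 76 * q ^ 2 +
          544 * q ^ 4 * Real.exp (2 * q ^ 2)) +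
        |t'| * (4 * Real.pi * q ^ 2 + 289 * q ^ 2 + 3402 * q ^ 4 * Real.exp (2 * q ^ 2)))) *
        (5 : ℝ) ^ (4 * q - 4 * Real.pi * b * q ^ 2), hf4, fun L _ x y => ?_⟩
    rw [mul_assoc]
    exact norm_spinCorr_ttPrime_le_rpow_euclid L t t' U μ β q hβ.le hq0 (by linarith) x y

/-! ### The one-particle Green's function of the `t–t'` model -/

/-- **Sharp explicit power law for the one-particle Green's function of the `t–t'` model**
(bounds.tex Thm 10‴(t′) (c)). For all real `t, t', U, μ`, `β ≥ 0`, `q ≥ 0` with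
`f = 2q - 4πβ(|t| + 2|t'|)q² ≥ 0`, every torus `L ≥ 1`, all sites `x, y` and a spin `σ`:
`|⟨c†_{xσ} c_{yσ}⟩_{β,L}| ≤ K 5^f (dist(x,y) + 1)^{-f}`. With `q* = 1/(4πβ(|t|+2|t'|))`:
`f₁* = T/(4π(|t| + 2|t'|))`. -/
theorem norm_green_ttPrime_le_rpow_euclid (L : ℕ) [NeZero L] (t t' U μ β q : ℝ)
    (hβ : 0 ≤ β) (hq : 0 ≤ q)
    (hf : 0 ≤ 2 * q - 4 * Real.pi * (β * (|t| + 2 * |t'|)) * q ^ 2) (x y : TorusSite 2 L)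
    (σ : Fin 2) :
    ‖(hubbardTorusTT' L t t' U - (μ : ℂ) • totalNumber).thermalCorr β
        (creation (orb (FermionTorus.ofTorusSite x) σ))
        (annihilation (orb (FermionTorus.ofTorusSite y) σ))‖ ≤
      Real.exp (2 * β * (|t| * (2 * Real.pi * q ^ 2 + 76 * q ^ 2 +
            544 * q ^ 4 * Real.exp (2 * q ^ 2)) +
          |t'| * (4 * Real.pi * q ^ 2 + 289 * q ^ 2 + 3402 * q ^ 4 * Real.exp (2 * q ^ 2)))) *
        ((5 : ℝ) ^ (2 * q - 4 * Real.pi * (β * (|t| + 2 * |t'|)) * q ^ 2) *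
          ((torusDist x y : ℝ) + 1) ^ (-(2 * q - 4 * Real.pi * (β * (|t| + 2 * |t'|)) * q ^ 2))) :=
  le_rpow_euclid_two_graphs_of_apriori L β |t| |t'| 1 q _ _ hβ (abs_nonneg t) (abs_nonneg t') hq
    x y (fun φ => by
      simpa only [one_mul] using
        norm_thermalCorr_creation_annihilation_ttPrime_le_sharp t t' U μ hβ φ x y σ)
    (by ring) hf

/-- **One-particle decay of the `t–t'` class, torus-uniform form (PROVED below).** Grand-canonical
`t–t'` Hubbard model on `(ℤ/Lℤ)²`, any real `t, t', U, μ`, `β > 0`, a spin `σ`: there is `C` with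
`|⟨c†_{xσ} c_{yσ}⟩_{β,L}| ≤ C (dist(x,y)+1)^{-T/(4π(|t| + 2|t'|))}` for EVERY `L ≥ 1` and all
`x, y` (at `t = t' = 0` the exponent reads `0` by the `1/0 = 0` convention and the bound is
`|·| ≤ C`). kind: support (PROVED). Why it might fail: it cannot (proved); NOT claimed: optimality
of the exponent, or any momentum-space (Fermi-surface) statement.
Sources: KomaTasakiPRL1992 eqs. (5)–(12), note 9; McBryanSpencer1977; XuEtAl2024 eq. (1). -/
@[conjecture] def GreenDecayEuclidTPrime : Prop :=
  ∀ (t t' U μ β : ℝ), 0 < β → ∀ (σ : Fin 2), ∃ C : ℝ, ∀ (L : ℕ) [NeZero L] (x y : TorusSite 2 L),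
    ‖(hubbardTorusTT' L t t' U - (μ : ℂ) • totalNumber).thermalCorr β
        (creation (orb (FermionTorus.ofTorusSite x) σ))
        (annihilation (orb (FermionTorus.ofTorusSite y) σ))‖ ≤
      C * ((torusDist x y : ℝ) + 1) ^ (-(1 / (4 * Real.pi * (β * (|t| + 2 * |t'|)))))

/-- **`GreenDecayEuclidTPrime` holds**: `norm_green_ttPrime_le_rpow_euclid` at
`q* = 1/(4πβ(|t| + 2|t'|))`, where `f = 2q* - 4πβ(|t|+2|t'|)q*² = q*` (also when the hopping
vanishes, by `1/0 = 0`); `C = K 5^{q*}`. -/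
theorem greenDecayEuclidTPrime_holds : GreenDecayEuclidTPrime := by
  intro t t' U μ β hβ σ
  set b : ℝ := β * (|t| + 2 * |t'|) with hbdef
  have hb0 : 0 ≤ b := by positivity
  set q : ℝ := 1 / (4 * Real.pi * b) with hqdef
  have hq0 : 0 ≤ q := by positivity
  have hfq : 2 * q - 4 * Real.pi * b * q ^ 2 = q := by
    rcases hb0.eq_or_lt with h | h
    · have hq : q = 0 := by rw [hqdef, ← h, mul_zero, div_zero]
      rw [hq]; ring
    · rw [hqdef]
      field_simp
      ring
  have hf0 : 0 ≤ 2 * q - 4 * Real.pi * b * q ^ 2 := by rw [hfq]; exact hq0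
  refine ⟨Real.exp (2 * β * (|t| * (2 * Real.pi * q ^ 2 + 76 * q ^ 2 +
        544 * q ^ 4 * Real.exp (2 * q ^ 2)) +
      |t'| * (4 * Real.pi * q ^ 2 + 289 * q ^ 2 + 3402 * q ^ 4 * Real.exp (2 * q ^ 2)))) *
      (5 : ℝ) ^ q, fun L _ x y => ?_⟩
  have main := norm_green_ttPrime_le_rpow_euclid L t t' U μ β q hβ.le hq0 hf0 x y σ
  rw [hfq] at main
  rw [mul_assoc]
  exact main

end Summit.HubbardSuperconductivity.HubbardLadder.Bounds

end
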